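import Mathlib.RingTheory.Perfectoid.FontaineTheta
import HarnessLib

/-!
# Functoriality of the tilt and naturality of Fontaine's `θ`

Mathlib constructs, for a commutative ring `O` in which the prime `p` is not a unit and which is
`p`-adically complete and separated, the tilt `O♭ = PreTilt O p = lim_{x ↦ x^p} O/p`, the sharp map
`♯ : O♭ → O` (`PreTilt.untilt`) and Fontaine's `θ : 𝕎(O♭) → O` (`WittVector.fontaineTheta`), but not
their functoriality in `O`. For a ring homomorphism `g : O → O'` between two such rings we define
the induced maps `g mod p` (`modPMap g`), `g♭ : O♭ → O'♭` (`tiltMap g`, coefficientwise) and prove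

* `untilt_tiltMap` : `(g♭ x)♯ = g (x♯)`;
* `fontaineTheta_map_tiltMap` : **`θ_{O'} ∘ 𝕎(g♭) = g ∘ θ_O`** — naturality of Fontaine's `θ`
  (Fontaine 1994, Exp. II §1.2: `θ` is functorial; the special case `O = O' = 𝒪_{ℂ_F}`, `g = σ ∈ Γ_F`
  is `fontaineTheta_galAinf` of `FontaineThetaGalois`, whose proof is followed here verbatim:
  modulo `p^(n+1)` both sides are ring maps out of `𝕎(O♭)` agreeing on Teichmüller representatives,
  Mathlib `WittVector.eq_of_apply_teichmuller_eq`, and `O'` is `p`-adically separated);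
* `tiltMap_comp`, `tiltMap_id` (functoriality), used for equivariance statements;
* an auxiliary change-of-ideal lemma for adic completeness, `isAdicComplete_of_le_of_pow_le`:
  if `J ≤ I` and `I ^ e ≤ J` then `I`-adic completeness implies `J`-adic completeness (the two
  topologies coincide) — used to pass from `ϖ`-adic to `p`-adic completeness of rings of integers.

All [folklore] / Fontaine 1994 Exp. II §1.2; Fontaine–Ouyang §4.2–4.4.

## References
* [FontaineAsterisque223III] J.-M. Fontaine, *Le corps des périodes p-adiques*, Astérisque 223
  (1994), Exp. II, §1.2.
* [FontaineOuyang2022] J.-M. Fontaine, Y. Ouyang, *Theory of p-adic Galois representations*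
  (book draft), §4.2–§4.4.
-/

noncomputable section

open Ideal Perfection WittVector

namespace Literature.NumberTheory.PAdicHodge

/-! ### Change of ideal for adic completeness -/

section AdicComplete

variable {R : Type*} [CommRing R] {M : Type*} [AddCommGroup M] [Module R M] {I J : Ideal R}

/-- If `J ≤ I`, an `I`-adically separated module is `J`-adically separated. [folklore] -/
theorem isHausdorff_of_le (hJI : J ≤ I) [IsHausdorff I M] : IsHausdorff J M := by
  refine ⟨fun x hx => IsHausdorff.haus' (I := I) x fun n => ?_⟩
  exact (hx n).mono (Submodule.smul_mono_left (Ideal.pow_right_mono hJI n))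

/-- If `J ≤ I` and `I ^ e ≤ J`, an `I`-adically precomplete module is `J`-adically precomplete:
a `J`-Cauchy sequence is `I`-Cauchy, and its `I`-adic limit is a `J`-adic limit because
`J ^ n ⊇ I ^ (e n)`. [folklore] -/
theorem isPrecomplete_of_le_of_pow_le (hJI : J ≤ I) {e : ℕ} (hIJ : I ^ e ≤ J) [IsPrecomplete I M] :
    IsPrecomplete J M := by
  rcases Nat.eq_zero_or_pos e with rfl | he
  · -- `I ^ 0 = ⊤ ≤ J`: the `J`-adic topology is indiscrete
    have hJ : J = ⊤ := top_le_iff.mp (by simpa using hIJ)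
    subst hJ
    refine ⟨fun {f} _ => ⟨0, fun n => ?_⟩⟩
    rw [Ideal.top_pow, Submodule.top_smul]
    exact SModEq.top
  refine ⟨fun {f} hf => ?_⟩
  -- `f` is `I`-Cauchy
  have hfI : ∀ {m n : ℕ}, m ≤ n → f m ≡ f n [SMOD (I ^ m • ⊤ : Submodule R M)] := fun {m n} hmn =>
    (hf hmn).mono (Submodule.smul_mono_left (Ideal.pow_right_mono hJI m))
  obtain ⟨L, hL⟩ := IsPrecomplete.prec' f hfI
  refine ⟨L, fun n => ?_⟩
  have h1 : f n ≡ f (e * n) [SMOD (J ^ n • ⊤ : Submodule R M)] := hf (Nat.le_mul_of_pos_left n he)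
  have h3 : f (e * n) ≡ L [SMOD (J ^ n • ⊤ : Submodule R M)] := by
    refine (hL (e * n)).mono (Submodule.smul_mono_left ?_)
    rw [pow_mul]
    exact Ideal.pow_right_mono hIJ n
  exact h1.trans h3

/-- **Change of ideal**: if `J ≤ I` and `I ^ e ≤ J` (so the `I`-adic and `J`-adic topologies agree),
an `I`-adically complete module is `J`-adically complete. [folklore] -/
theorem isAdicComplete_of_le_of_pow_le (hJI : J ≤ I) {e : ℕ} (hIJ : I ^ e ≤ J) [IsAdicComplete I M] :
    IsAdicComplete J M :=
  haveI := isHausdorff_of_le (M := M) hJI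
  haveI := isPrecomplete_of_le_of_pow_le (M := M) hJI hIJ
  ⟨⟩

end AdicComplete

/-! ### Functoriality of `O ↦ O/p`, `O ↦ O♭` -/

section Functoriality

variable {O O' O'' : Type*} [CommRing O] [CommRing O'] [CommRing O''] {p : ℕ}
  (g : O →+* O') (g' : O' →+* O'')

/-- A ring homomorphism maps `(p)^n` into `(p)^n`. [folklore] -/
theorem map_mem_span_natCast_pow (n : ℕ) {x : O} (hx : x ∈ Ideal.span {(p : O)} ^ n) :
    g x ∈ Ideal.span {(p : O')} ^ n := by
  rw [Ideal.span_singleton_pow, Ideal.mem_span_singleton] at hx ⊢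
  simpa using map_dvd g hx

variable (p) in
/-- **`g mod p : O/p → O'/p`.** [folklore] -/
def modPMap : ModP O p →+* ModP O' p :=
  Ideal.quotientMap (Ideal.span {(p : O')}) g <| by
    rw [Ideal.span_le, Set.singleton_subset_iff, SetLike.mem_coe, Ideal.mem_comap, map_natCast]
    exact Ideal.mem_span_singleton_self _

/-- `modPMap` on residue classes. [folklore] -/
@[simp] theorem modPMap_mk (x : O) :
    modPMap p g (Ideal.Quotient.mk (Ideal.span {(p : O)}) x) = Ideal.Quotient.mk (Ideal.span {(p : O')}) (g x) :=
  rfl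

/-- `modPMap` is functorial. [folklore] -/
theorem modPMap_comp_apply (x : ModP O p) : modPMap p (g'.comp g) x = modPMap p g' (modPMap p g x) := by
  obtain ⟨x, rfl⟩ := Ideal.Quotient.mk_surjective x
  rfl

/-- `modPMap id = id`. [folklore] -/
theorem modPMap_id_apply (x : ModP O p) : modPMap p (RingHom.id O) x = x := by
  obtain ⟨x, rfl⟩ := Ideal.Quotient.mk_surjective x
  rfl

variable [Fact p.Prime] [Fact (¬ IsUnit (p : O))] [Fact (¬ IsUnit (p : O'))] [Fact (¬ IsUnit (p : O''))]

variable (p) in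
/-- **`g♭ : O♭ → O'♭`**, the map induced on tilts (coefficientwise `g mod p`; Mathlib `Perfection.map`).
[cite: FontaineAsterisque223III, Exp. II §1.2] -/
def tiltMap : PreTilt O p →+* PreTilt O' p :=
  Perfection.map p (modPMap p g)

/-- Coefficients of `g♭ x`. [folklore] -/
@[simp] theorem coeff_tiltMap (x : PreTilt O p) (n : ℕ) :
    PreTilt.coeff n (tiltMap p g x) = modPMap p g (PreTilt.coeff n x) := rfl

/-- `(g' ∘ g)♭ = g'♭ ∘ g♭`. [folklore] -/
theorem tiltMap_comp_apply (x : PreTilt O p) : tiltMap p (g'.comp g) x = tiltMap p g' (tiltMap p g x) := by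
  refine Perfection.ext fun n => ?_
  change PreTilt.coeff n _ = PreTilt.coeff n _
  rw [coeff_tiltMap, coeff_tiltMap, coeff_tiltMap, modPMap_comp_apply]

/-- `id♭ = id`. [folklore] -/
theorem tiltMap_id_apply (x : PreTilt O p) : tiltMap p (RingHom.id O) x = x := by
  refine Perfection.ext fun n => ?_
  change PreTilt.coeff n _ = PreTilt.coeff n _
  rw [coeff_tiltMap, modPMap_id_apply]

/-- Two tilt maps agree as soon as the ring maps agree (congruence helper). [folklore] -/
theorem tiltMap_congr {g₁ g₂ : O →+* O'} (h : ∀ x, g₁ x = g₂ x) (x : PreTilt O p) :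
    tiltMap p g₁ x = tiltMap p g₂ x := by
  have : g₁ = g₂ := RingHom.ext h
  subst this; rfl

/-! ### Naturality of `♯` and of `θ` -/

variable [IsAdicComplete (Ideal.span {(p : O)}) O] [IsAdicComplete (Ideal.span {(p : O')}) O']

omit [Fact (¬ IsUnit (p : O''))] in
/-- **The sharp map is natural**: `(g♭ x)♯ = g (x♯)` — both are limits of `pⁿ`-th powers of lifts of
the coefficients (uniqueness in Mathlib `Perfection.teichmuller_spec`).
[cite: FontaineAsterisque223III, Exp. II §1.2] [cite: FontaineOuyang2022, Prop. 4.3.2] -/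
theorem untilt_tiltMap (x : PreTilt O p) : PreTilt.untilt (tiltMap p g x) = g (PreTilt.untilt x) := by
  change Perfection.teichmuller p (Ideal.span {(p : O')}) (tiltMap p g x) = _
  refine Perfection.teichmuller_spec fun n => ?_
  set z₀ : O := (PreTilt.coeff n x).out
  have hz₀ : Ideal.Quotient.mk (Ideal.span {(p : O)}) z₀ = Perfection.coeff _ p n x :=
    Ideal.Quotient.mk_out _
  refine ⟨g z₀, ?_, ?_⟩
  · change modPMap p g (Ideal.Quotient.mk _ z₀) = modPMap p g (PreTilt.coeff n x)
    rw [hz₀]; rfl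
  · have h1 : Perfection.teichmuller p (Ideal.span {(p : O)}) x ≡ z₀ ^ p ^ n
        [SMOD Ideal.span {(p : O)} ^ (n + 1)] := Perfection.teichmuller_sModEq hz₀
    rw [SModEq.sub_mem] at h1 ⊢
    have h2 := map_mem_span_natCast_pow g (n + 1) h1
    rw [map_sub, map_pow] at h2
    rw [← neg_sub]
    exact Submodule.neg_mem _ h2

omit [Fact p.Prime] [Fact (¬ IsUnit (p : O'))] [Fact (¬ IsUnit (p : O''))]
  [IsAdicComplete (Ideal.span {(p : O')}) O'] in
/-- `p` is nilpotent in `O'/p^(n+1)`. [folklore] -/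
theorem isNilpotent_natCast_quotient_span_pow (n : ℕ) :
    IsNilpotent ((p : O' ⧸ Ideal.span {(p : O')} ^ (n + 1))) := by
  refine ⟨n + 1, ?_⟩
  rw [← map_natCast (Ideal.Quotient.mk (Ideal.span {(p : O')} ^ (n + 1))), ← map_pow,
    Ideal.Quotient.eq_zero_iff_mem]
  exact Ideal.pow_mem_pow (Ideal.mem_span_singleton_self _) _

omit [Fact p.Prime] [Fact (¬ IsUnit (p : O'))] [Fact (¬ IsUnit (p : O''))] in
/-- Two elements of `O'` congruent modulo every `pⁿ` are equal. [folklore] -/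
theorem eq_of_forall_sub_mem_span_pow {x y : O'} (h : ∀ n, x - y ∈ Ideal.span {(p : O')} ^ n) : x = y := by
  rw [← sub_eq_zero]
  refine IsHausdorff.haus (IsAdicComplete.toIsHausdorff (I := Ideal.span {(p : O')})) (x - y) fun n => ?_
  rw [SModEq.zero, smul_eq_mul, Ideal.mul_top]
  exact h n

omit [Fact (¬ IsUnit (p : O''))] in
/-- **Naturality of Fontaine's `θ`**: `θ_{O'} (𝕎(g♭) x) = g (θ_O x)` for every `x ∈ 𝕎(O♭)`.
[cite: FontaineAsterisque223III, Exp. II §1.2] [cite: FontaineOuyang2022, §4.4] -/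
theorem fontaineTheta_map_tiltMap (x : WittVector p (PreTilt O p)) :
    fontaineTheta O' p (WittVector.map (tiltMap p g) x) = g (fontaineTheta O p x) := by
  refine eq_of_forall_sub_mem_span_pow (p := p) fun n => ?_
  cases n with
  | zero => rw [pow_zero, Ideal.one_eq_top]; exact Submodule.mem_top
  | succ n =>
    set I : Ideal O' := Ideal.span {(p : O')} with hI
    let f₁ : WittVector p (PreTilt O p) →+* O' ⧸ I ^ (n + 1) :=
      (Ideal.Quotient.mk (I ^ (n + 1))).comp ((fontaineTheta O' p).comp (WittVector.map (tiltMap p g)))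
    let f₂ : WittVector p (PreTilt O p) →+* O' ⧸ I ^ (n + 1) :=
      (Ideal.Quotient.mk (I ^ (n + 1))).comp (g.comp (fontaineTheta O p))
    have hfg : f₁ = f₂ := by
      refine WittVector.eq_of_apply_teichmuller_eq f₁ f₂ (isNilpotent_natCast_quotient_span_pow n) fun y => ?_
      change Ideal.Quotient.mk _ (fontaineTheta O' p (WittVector.map (tiltMap p g) (teichmuller p y))) =
        Ideal.Quotient.mk _ (g (fontaineTheta O p (teichmuller p y)))
      rw [WittVector.map_teichmuller, fontaineTheta_teichmuller, fontaineTheta_teichmuller, untilt_tiltMap]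
    have := congrArg (fun φ => φ x) hfg
    change Ideal.Quotient.mk _ (fontaineTheta O' p (WittVector.map (tiltMap p g) x)) =
      Ideal.Quotient.mk _ (g (fontaineTheta O p x)) at this
    rwa [Ideal.Quotient.eq] at this

end Functoriality

end Literature.NumberTheory.PAdicHodge

end
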